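import Mathlib
import HarnessLib
import Summits.ValiantsHypothesis.ValiantsHypothesis.Theses.MonotoneRestoration
import Literature.Computability.AlgebraicComplexity.ArithCircuit
import Literature.Computability.AlgebraicComplexity.ArithCircuitProofs
import Literature.Computability.AlgebraicComplexity.MonotoneStructure
import Literature.Computability.AlgebraicComplexity.PermanentIrreducible
import Literature.ModelTheory.FiniteModelTheory.CkEquiv
import Summits.ValiantsHypothesis.ValiantsHypothesis.Theorems.MonotoneRestorationMonotoneRestorationQPCosetCount
import Summits.ValiantsHypothesis.ValiantsHypothesis.Theorems.MonotoneRestorationMonotoneRestorationQPSymmetricLB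
import Summits.ValiantsHypothesis.ValiantsHypothesis.Theorems.MonotoneRestorationMonotoneRestorationQPSupportSymmetrisation
import Summits.ValiantsHypothesis.ValiantsHypothesis.Theorems.MonotoneRestorationMonotoneRestorationQPSparseRegime
import Summits.ValiantsHypothesis.ValiantsHypothesis.Theorems.MonotoneRestorationMonotoneRestorationQPBeta
import Literature.Computability.AlgebraicComplexity.SymmetricArithCircuit
import Literature.Computability.AlgebraicComplexity.DawarWilsenach2025Proofs
import Literature.GroupTheory.PermutationGroups.SmallIndexSubgroups
import Summits.ValiantsHypothesis.ValiantsHypothesis.Theorems.MonotoneRestorationQP.Negative.LoadBearing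
import Summits.ValiantsHypothesis.ValiantsHypothesis.Theorems.MonotoneRestorationMonotoneRestorationQPPermSupportCount
import Summits.ValiantsHypothesis.ValiantsHypothesis.Theorems.MonotoneRestorationMonotoneRestorationQPGateSupport

/-! TTRL-lite variant V14314 of stmt-ValiantsHypothesis-15886

Target `stub_gateSupport`, move `small_case` (`bound_nat:k≤5`): the registered stub with the extra
(idle) hypothesis `k ≤ 5`. The stub itself is landed as
`Summit.ValiantsHypothesis.ValiantsHypothesis.Theorems.stub_gateSupport`
(`MonotoneRestorationMonotoneRestorationQPGateSupport.lean`); this variant is its specialisation.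
-/

-- `Summit.ValiantsHypothesis.ValiantsHypothesis.…` is the tree's mandated single-conjunct layout
-- (Sub = Summit), so the duplicated namespace component is intended.
set_option linter.dupNamespace false

namespace Summit.ValiantsHypothesis.ValiantsHypothesis.Theorems

open Summit.ValiantsHypothesis.ValiantsHypothesis.Theses.MonotoneRestoration
open Literature.Computability.AlgebraicComplexity

/-- **TTRL-lite variant V14314 (`k ≤ 5`) of `stub_gateSupport`** (support theorem, gate-stabiliser
form). In a `Sym_n`-symmetric labelled circuit with fewer than `C(n,k)` gates (`n > 8`, `1 ≤ k ≤ 5`,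
`4k ≤ n`), every gate `g` admits a set `X` of fewer than `k` indices such that every EVEN
permutation fixing `X` pointwise extends to an automorphism fixing `g`. Immediate from the landed
stub `stub_gateSupport` (the bound `k ≤ 5` is not used): the permutations having an extension that
fixes `g` form a subgroup of index `≤ |G| < C(n,k)`, then Dixon–Mortimer 5.2B.
[cite: DawarWilsenach2025, §6 (support theorem); DixonMortimer1996, Thm 5.2B] -/
theorem stub_gateSupport_var14314 :
    ∀ (n : ℕ) (K : Type) (G : Type) [Fintype G] (C : LabelledArithCircuit K (Fin n × Fin n) Unit G)
      (hC : C.IsSymmetric (Equiv.Perm (Fin n))) (k : ℕ) (hn : 8 < n) (hk : 1 ≤ k) (h4k : 4 * k ≤ n)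
      (hcard : Fintype.card G < n.choose k) (g : G), k ≤ 5 →
      ∃ X : Finset (Fin n), X.card < k ∧ ∀ ρ : Equiv.Perm (Fin n), (∀ x ∈ X, ρ x = x) →
        Equiv.Perm.sign ρ = 1 → ∃ π : Equiv.Perm G, C.IsAutomorphismExtending ρ π ∧ π g = g := by
  intro n K G _ C hC k hn hk h4k hcard g _
  exact stub_gateSupport C hC hn hk h4k hcard g

end Summit.ValiantsHypothesis.ValiantsHypothesis.Theorems
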